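import Literature.IUT.LogThetaLattice.PacketLogVolumesHaarModelCapsulesSingleton
import HarnessLib

/-!
# [IUTchIII] Proposition 3.9 (i)/(iii) for CAPSULES at the genuine adelic Haar model, IX: at `|A| = 1` the capsule
# log-volume IS the single-place log-volume on EVERY admissible region (measure transport `⊗_{ℚ_p}^{α∈A} F_{v_α} ≅ F_v`;
# abc-iut cell, layer L6; row CAP39 part IX, abc-iut-L6-d3)

S. Mochizuki, *Inter-universal Teichmüller theory III*, kurims manuscript (May 2020), Proposition 3.9 (i), p. 115: "when
`|A| = 1`, i.e., `A = {α}`, we write `μ^log_{α,v_ℚ}`"; "`μ^log_{A,v_ℚ} : 𝕄(𝓘^ℚ(^A𝓕_{v_ℚ})) → ℝ` … by [weighted sums of]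
the `p_{v_ℚ}`-adic log-volumes on each of the direct summand `p_{v_ℚ}`-adic fields" [claim: Mochizuki2012, status:
disputed]; *Inter-universal Teichmüller theory IV*, Proposition 1.4 (i), p. 13 (the packet log-volume "normalized so
that `μ^log((R_E)^∼) = 0`" by transport of structure along the decomposition into fields); S. Mochizuki, *Topics in
Absolute Anabelian Geometry III*, Proposition 5.7 (i)(a), p. 137 (uniqueness of the normalised Haar volume `μ_k`,
`μ_k(𝒪_k) = 1`).

WHAT THIS FILE ADDS. The row CAP39 has two genuine containers at a finite place: the SINGLE-PLACE model of record
(p415871 `nonarchDatum F v`: Mathlib's `F_v = v.adicCompletion F`, campaign-S `localVolume`, weight `c_v = 1/[F:ℚ]`) and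
the capsule portions (p418604 `nonarchPortion F A p v⃗`: the tensor packet `⊗_{ℚ_p}^{α∈A} F_{v_α}` over abc-iut-S7's
`RescaledCompletion`, campaign-S `tensorLogVolume`, weight `∏_α n_{v_α}/[F:ℚ]`). Part VIII (p426201) proved that for
`|A| = 1` they give the IDEAL regions the same weighted log-volumes. Here the junction on EVERY admissible region, by
measure transport:
* §1 (campaign-S level) `packetSubsingletonContinuousAddEquiv p k i₀ : ⊗_{ℚ_p}^{i∈I} k_i ≃ₜ+ k_{i₀}` (the one-factor
  algebra isomorphism of part VIII as a bicontinuous additive isomorphism — both sides carry the module topology) and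
  **`image_normalizedPacket_packetSubsingletonAlgEquiv : e((R_I)^∼) = 𝒪_{k_{i₀}}`** (abc-iut-S8's `image_normalizedPacket`);
* §2 the junction map **`singletonPortionEquiv : ⊗_{ℚ_p}^{α∈A} F_{v_α} ≃ₜ+ F_{v_{α₀}}`** (`A` a subsingleton; through S7's
  `RescaledCompletion.of`, the identity of `F_v` with its rescaled-norm synonym), carrying `(R_I)^∼` onto `𝒪_v`
  (`singletonPortionEquiv_image_normalizedPacket`), hence by Haar uniqueness (campaign-S
  `IntegralStructure.logVolume_image_equiv` / `haar_image_equiv`):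
  **`localDegree_mul_logVol_eq_logVol_image : n_v · μ^log_{⊗}(S) = μ^log_v(e(S))`** for every admissible `S`
  (`tensorLogVolume` is dimension-normalised, `localVolume` is not), the admissibility transfer
  `isAdm_iff_vol_image`, and the WEIGHTED form **`placeProbWeight_mul_logVol_eq : (n_v/[F:ℚ])·μ^log_{⊗}(S) =
  (1/[F:ℚ])·μ^log_v(e(S))`** — model weight × model log-volume agree term by term;
* §3 at the packet over `p`: **`capsulePacketLogVolume_prime_singleton : μ^log_{A,p}(T) = μ^log_p(e(T))`** for EVERY
  admissible family `T` of the `A`-packet with `|A| = 1` (p419250's `capsulePacketLogVolume` = p415871's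
  `haarPacketLogVolume` on the transported family `singletonPacketRegion T`).

HONEST SCOPE. Finite places only: at an archimedean place the two containers of the row carry DIFFERENT volume notions
that agree on the centred discs `e^t·𝒪_ℂ` (the Example 3.6 (ii) objects; part VIII) but not on arbitrary regions —
p415871's `archDatum` has [AbsTopIII] Prop. 5.7 (ii)'s RADIAL volume (Lebesgue length of the set of radii), p418604's
`archPortion` the hermitian-metric (Lebesgue) volume of [IUTchIV] Prop. 1.5 (iii) on `M_I = ℂ`, dimension-normalised;
e.g. a half-disc of radius `r` has radial log-volume `log r` but normalised Lebesgue log-volume `log r − (log 2)/2`. No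
general-region junction is claimed at `∞`. `K = F_mod = F`; nothing here bears on [IUTchIII] Cor. 3.12 or takes a side;
typed ≠ endorsed. Classical (Haar uniqueness). [cite: MochizukiAbsTopIII2015, Prop. 5.7 (i)(a) p. 137]
[cite: Mochizuki2012, IUTchIV Prop. 1.4 (i) p. 13]
-/

noncomputable section

/-! ### §1 The one-factor packet as a bicontinuous additive isomorphism; the image of `(R_I)^∼` -/

namespace Literature.IUT.LogVolume

open MeasureTheory Set Metric

section Subsingleton

variable (p : ℕ) [Fact p.Prime] {I : Type} [Fintype I] [DecidableEq I]
variable (k : I → Type) [∀ i, NontriviallyNormedField (k i)] [∀ i, NormedAlgebra ℚ_[p] (k i)]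
  [∀ i, IsUltrametricDist (k i)] [∀ i, ProperSpace (k i)]

/-- **`V = ⊗_{ℚ_p}^{i∈I} k_i ≃ₜ+ k_{i₀}` for a subsingleton `I`**: part VIII's algebra isomorphism
`packetSubsingletonAlgEquiv` is bicontinuous — both sides carry the `ℚ_p`-module topology (campaign-S's packet topology;
`k_{i₀}` is finite-dimensional, Riesz), for which linear maps are continuous (the one-factor case of abc-iut-S7's
`decompositionEquiv`). [cite: Mochizuki2012, IUTchIV Prop. 1.4 (i) p. 13] -/
def packetSubsingletonContinuousAddEquiv [Subsingleton I] (i₀ : I) : PacketAlgebra p k ≃ₜ+ k i₀ :=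
  haveI : FiniteDimensional ℚ_[p] (k i₀) := finiteDimensional p (k i₀)
  haveI : IsModuleTopology ℚ_[p] (k i₀) := isModuleTopologyOfFiniteDimensional
  haveI : ContinuousAdd (PacketAlgebra p k) := IsModuleTopology.toContinuousAdd ℚ_[p] _
  { (packetSubsingletonAlgEquiv p k i₀).toLinearEquiv.toAddEquiv with
    continuous_toFun :=
      IsModuleTopology.continuous_of_linearMap (packetSubsingletonAlgEquiv p k i₀).toLinearEquiv.toLinearMap
    continuous_invFun :=
      IsModuleTopology.continuous_of_linearMap (packetSubsingletonAlgEquiv p k i₀).toLinearEquiv.symm.toLinearMap }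

omit [Fintype I] [DecidableEq I] in
/-- Unfolding: the bicontinuous isomorphism is `packetSubsingletonAlgEquiv` on elements.
[cite: Mochizuki2012, IUTchIV Prop. 1.4 (i) p. 13] -/
@[simp] theorem packetSubsingletonContinuousAddEquiv_apply [Subsingleton I] (i₀ : I) (x : PacketAlgebra p k) :
    packetSubsingletonContinuousAddEquiv p k i₀ x = packetSubsingletonAlgEquiv p k i₀ x := rfl

/-- **`e((R_I)^∼) = 𝒪_{k_{i₀}}`**: the one-factor isomorphism carries the integral structure `(R_I)^∼` of the packet
onto the closed unit ball of `k_{i₀}` (abc-iut-S8's `image_normalizedPacket` — `ℤ_p`-integrality is preserved and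
`𝒪 = {‖·‖ ≤ 1}` is the set of `ℤ_p`-integral elements — at the one-factor decomposition of part VIII).
[cite: Mochizuki2012, IUTchIV Prop. 1.4 (i) p. 13] -/
theorem image_normalizedPacket_packetSubsingletonAlgEquiv [Nonempty I] [Subsingleton I] (i₀ : I) :
    packetSubsingletonAlgEquiv p k i₀ '' (normalizedPacket p k : Set (PacketAlgebra p k)) =
      closedBall (0 : k i₀) 1 := by
  have h := image_normalizedPacket p k (fun _ : Unit => k i₀) (packetSubsingletonDecomposition p k i₀)
  ext y
  constructor
  · rintro ⟨x, hx, rfl⟩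
    have hy : packetSubsingletonDecomposition p k i₀ x ∈ polydisc (fun _ : Unit => k i₀) (fun _ => 1) :=
      h ▸ Set.mem_image_of_mem _ hx
    rw [mem_polydisc] at hy
    simpa [mem_closedBall, dist_zero_right] using hy ()
  · intro hy
    have hy' : (fun _ : Unit => y) ∈ polydisc (fun _ : Unit => k i₀) (fun _ => 1) := by
      rw [mem_polydisc]
      intro _
      simpa [mem_closedBall, dist_zero_right] using hy
    rw [← h] at hy'
    obtain ⟨x, hx, hxy⟩ := hy'
    exact ⟨x, hx, by simpa using congrFun hxy ()⟩

end Subsingleton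

end Literature.IUT.LogVolume

/-! ### §2 The junction map `⊗_{ℚ_p}^{α∈A} F_{v_α} ≃ₜ+ F_{v_{α₀}}` and the transport of log-volumes -/

namespace Literature.IUT.LogThetaLattice

open Literature.IUT.LogVolume Literature.NumberTheory.NumberFields NumberField IsDedekindDomain MeasureTheory Metric
  Set
open Literature.NumberTheory.GaloisRepresentations.Ultrametric
open scoped ENNReal NNReal

variable (F : Type) [Field F] [NumberField F]
variable (A : Type) [Fintype A] [DecidableEq A] [Nonempty A]

section Nonarch

variable (p : Nat.Primes)

/-- **The identity `F_v^{resc} ≃ₜ+ F_v`** between abc-iut-S7's rescaled-norm synonym `Kp F p v = RescaledCompletion` and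
Mathlib's `v.adicCompletion F` (S7's `RescaledCompletion.of`, a ring isomorphism which is the identity on the common
uniform structure). [cite: NeukirchANT1999, Ch. II Thm. (4.8)] -/
def kpContinuousAddEquiv (v : {v : HeightOneSpectrum (𝓞 F) // v ∈ placesOver F (p : ℕ)}) :
    Kp F p v ≃ₜ+ v.1.adicCompletion F :=
  { (RescaledCompletion.of F p v.1 (natCast_mem_of_mem_placesOver p v.2)).symm.toAddEquiv with
    continuous_toFun := continuous_id
    continuous_invFun := continuous_id }

/-- Unfolding: the identity on elements. [cite: NeukirchANT1999, Ch. II Thm. (4.8)] -/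
@[simp] theorem kpContinuousAddEquiv_apply (v : {v : HeightOneSpectrum (𝓞 F) // v ∈ placesOver F (p : ℕ)})
    (x : Kp F p v) :
    kpContinuousAddEquiv F p v x = (RescaledCompletion.of F p v.1 (natCast_mem_of_mem_placesOver p v.2)).symm x := rfl

/-- The identity carries the rescaled unit ball `{‖·‖' ≤ 1}` onto `𝒪_v = {‖·‖_v ≤ 1}` (same set: `‖x‖' = ‖x‖_v^{1/n_v}`;
S7's `RescaledCompletion.closedBall_eq`). [cite: NeukirchANT1999, Ch. II Thm. (4.8)] -/
theorem kpContinuousAddEquiv_image_closedBall_one (v : {v : HeightOneSpectrum (𝓞 F) // v ∈ placesOver F (p : ℕ)}) :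
    kpContinuousAddEquiv F p v '' closedBall (0 : Kp F p v) 1 = closedBall (0 : v.1.adicCompletion F) 1 := by
  have h := RescaledCompletion.closedBall_eq F p v.1 (natCast_mem_of_mem_placesOver p v.2) (0 : Kp F p v) zero_le_one
  rw [map_zero, one_pow] at h
  rw [h, Set.image_image]
  convert Set.image_id _
  exact (RescaledCompletion.of F p v.1 (natCast_mem_of_mem_placesOver p v.2)).symm_apply_apply _

variable [Fact (p : ℕ).Prime] (vA : A → {v : HeightOneSpectrum (𝓞 F) // v ∈ placesOver F (p : ℕ)}) (α₀ : A)
  [Subsingleton A]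

/-- **The junction map at `|A| = 1`: `⊗_{ℚ_p}^{α∈A} F_{v_α} ≃ₜ+ F_{v_{α₀}}`** (`A` a subsingleton) — the one-factor
packet isomorphism of §1 followed by the identity `F_v^{resc} = F_v`. [claim: Mochizuki2012, status: disputed] -/
def singletonPortionEquiv : PacketAlgebra p (fun α => Kp F p (vA α)) ≃ₜ+ (vA α₀).1.adicCompletion F :=
  (packetSubsingletonContinuousAddEquiv p (fun α => Kp F p (vA α)) α₀).trans (kpContinuousAddEquiv F p (vA α₀))

omit [Fintype A] [DecidableEq A] [Nonempty A] in
/-- Unfolding the junction map on elements. [claim: Mochizuki2012, status: disputed] -/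
theorem singletonPortionEquiv_apply (x : PacketAlgebra p (fun α => Kp F p (vA α))) :
    singletonPortionEquiv F A p vA α₀ x =
      (RescaledCompletion.of F p (vA α₀).1 (natCast_mem_of_mem_placesOver p (vA α₀).2)).symm
        (packetSubsingletonAlgEquiv p (fun α => Kp F p (vA α)) α₀ x) := rfl

/-- **The junction map carries `(R_I)^∼` onto `𝒪_v`.** [claim: Mochizuki2012, status: disputed] -/
theorem singletonPortionEquiv_image_normalizedPacket :
    singletonPortionEquiv F A p vA α₀ ''
        (normalizedPacket p (fun α => Kp F p (vA α)) : Set (PacketAlgebra p (fun α => Kp F p (vA α)))) =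
      closedBall (0 : (vA α₀).1.adicCompletion F) 1 := by
  rw [show (⇑(singletonPortionEquiv F A p vA α₀) : PacketAlgebra p (fun α => Kp F p (vA α)) → (vA α₀).1.adicCompletion F) =
      (kpContinuousAddEquiv F p (vA α₀)) ∘ (packetSubsingletonAlgEquiv p (fun α => Kp F p (vA α)) α₀) from rfl,
    Set.image_comp, image_normalizedPacket_packetSubsingletonAlgEquiv, kpContinuousAddEquiv_image_closedBall_one]

/-- The volume of p415871's `nonarchDatum` IS the `𝒪_v`-normalised Haar measure of `F_v` (campaign-S `localVolume` =
`(unitBallStructure F_v).haar`; definitional, recorded with the instances p415871 uses).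
[claim: Mochizuki2012, status: disputed] -/
theorem nonarchDatum_vol_eq (v : HeightOneSpectrum (𝓞 F)) (T : Set (v.adicCompletion F)) :
    (nonarchDatum F v).vol T =
      (letI := AdicCompletion.nontriviallyNormedField F v
       letI : ProperSpace (v.adicCompletion F) := Literature.NumberTheory.Automorphic.properSpace_adicCompletion F v
       letI : MeasurableSpace (v.adicCompletion F) := CompletionModel.measurableSpace F v
       haveI : BorelSpace (v.adicCompletion F) := ⟨rfl⟩
       (unitBallStructure (v.adicCompletion F)).haar T) := rfl

/-- **TRANSPORT OF THE INTEGRAL-STRUCTURE VOLUME**: the `(R_I)^∼`-normalised Haar measure of the one-factor packet IS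
the `𝒪_v`-normalised Haar measure of `F_v` along the junction map — `μ_{(R_I)^∼}(S) = μ_v(e(S))` for EVERY `S`
(campaign-S `IntegralStructure.haar_image_equiv`: `e` is a bicontinuous additive isomorphism with `e((R_I)^∼) = 𝒪_v`,
and the normalised Haar measure is unique, [AbsTopIII] Prop. 5.7 (i)(a)). [claim: Mochizuki2012, status: disputed] -/
theorem haar_normalizedIntegralStructure_eq_vol_image (S : Set (PacketAlgebra p (fun α => Kp F p (vA α)))) :
    (normalizedIntegralStructure p (fun α => Kp F p (vA α))).haar S =
      (nonarchDatum F (vA α₀).1).vol (singletonPortionEquiv F A p vA α₀ '' S) := by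
  letI := AdicCompletion.nontriviallyNormedField F (vA α₀).1
  letI : ProperSpace ((vA α₀).1.adicCompletion F) :=
    Literature.NumberTheory.Automorphic.properSpace_adicCompletion F (vA α₀).1
  letI : MeasurableSpace ((vA α₀).1.adicCompletion F) := CompletionModel.measurableSpace F (vA α₀).1
  haveI : BorelSpace ((vA α₀).1.adicCompletion F) := ⟨rfl⟩
  rw [nonarchDatum_vol_eq]
  exact ((normalizedIntegralStructure p (fun α => Kp F p (vA α))).haar_image_equiv
    (unitBallStructure ((vA α₀).1.adicCompletion F)) (singletonPortionEquiv F A p vA α₀)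
    (by rw [coe_normalizedIntegralStructure, coe_unitBallStructure]
        exact singletonPortionEquiv_image_normalizedPacket F A p vA α₀) S).symm

/-- **ADMISSIBILITY TRANSFERS**: `S ⊆ ⊗_{α} F_{v_α}` has positive finite Haar measure iff `e(S) ⊆ F_v` has (the packet's
admissibility is measured with `μ_{R_I}`, a positive finite multiple of `μ_{(R_I)^∼}`). [claim: Mochizuki2012, status: disputed] -/
theorem isAdm_iff_vol_image (S : Set (PacketAlgebra p (fun α => Kp F p (vA α)))) :
    (nonarchPortion F A p vA).IsAdm S ↔
      0 < (nonarchDatum F (vA α₀).1).vol (singletonPortionEquiv F A p vA α₀ '' S) ∧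
        (nonarchDatum F (vA α₀).1).vol (singletonPortionEquiv F A p vA α₀ '' S) < ⊤ := by
  rw [← haar_normalizedIntegralStructure_eq_vol_image]
  have hc0 : ((integerStructure p (fun α => Kp F p (vA α))).haar
      (normalizedIntegralStructure p (fun α => Kp F p (vA α)) : Set (PacketAlgebra p (fun α => Kp F p (vA α)))))⁻¹
        ≠ 0 :=
    ENNReal.inv_ne_zero.mpr ((integerStructure p _).haar_lt_top_of_isCompact
      (normalizedIntegralStructure p (fun α => Kp F p (vA α))).isCompact).ne
  have hct : ((integerStructure p (fun α => Kp F p (vA α))).haar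
      (normalizedIntegralStructure p (fun α => Kp F p (vA α)) : Set (PacketAlgebra p (fun α => Kp F p (vA α)))))⁻¹
        ≠ ⊤ :=
    ENNReal.inv_ne_top.mpr ((integerStructure p _).haar_pos_of_isOpen
      (normalizedIntegralStructure p (fun α => Kp F p (vA α))).isOpen
      (normalizedIntegralStructure p (fun α => Kp F p (vA α))).nonempty).ne'
  have key : (normalizedIntegralStructure p (fun α => Kp F p (vA α))).haar S =
      ((integerStructure p (fun α => Kp F p (vA α))).haar
        (normalizedIntegralStructure p (fun α => Kp F p (vA α)) : Set (PacketAlgebra p (fun α => Kp F p (vA α)))))⁻¹ *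
        (integerStructure p (fun α => Kp F p (vA α))).haar S := by
    rw [(integerStructure p (fun α => Kp F p (vA α))).haar_eq_smul_haar
      (normalizedIntegralStructure p (fun α => Kp F p (vA α))), Measure.smul_apply, smul_eq_mul]
  show 0 < (integerStructure p (fun α => Kp F p (vA α))).haar S ∧
      (integerStructure p (fun α => Kp F p (vA α))).haar S < ⊤ ↔ _
  rw [key]
  constructor
  · rintro ⟨h0, ht⟩
    exact ⟨ENNReal.mul_pos hc0 h0.ne', ENNReal.mul_lt_top hct.lt_top ht⟩
  · rintro ⟨h0, ht⟩
    refine ⟨pos_iff_ne_zero.mpr fun h => h0.ne' ?_, lt_top_iff_ne_top.mpr fun h => ht.ne ?_⟩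
    · rw [h, mul_zero]
    · rw [h, ENNReal.mul_top hc0]

/-- **THE JUNCTION ON EVERY ADMISSIBLE REGION: `n_v · μ^log_{⊗}(S) = μ^log_v(e(S))`.** For `|A| = 1` and an admissible
`S ⊆ ⊗_{ℚ_p}^{α∈A} F_{v_α}`, campaign-S's dimension-normalised `tensorLogVolume` (`= (log μ_{R_I}(S) − log μ_{R_I}((R_I)^∼))
/ dim_{ℚ_p}`, [IUTchIV] Prop. 1.4 (i)) times `n_v = [F_v:ℚ_p]` equals p415871's single-place `μ^log_v(e(S)) =
log μ_v(e(S))` ([AbsTopIII] Prop. 5.7 (i)). [claim: Mochizuki2012, status: disputed] -/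
theorem localDegree_mul_logVol_eq_logVol_image (S : Set (PacketAlgebra p (fun α => Kp F p (vA α))))
    (hS : (nonarchPortion F A p vA).IsAdm S) :
    (localDegree F (vA α₀).1 : ℝ) * (nonarchPortion F A p vA).logVol S =
      (nonarchDatum F (vA α₀).1).logVol (singletonPortionEquiv F A p vA α₀ '' S) := by
  have hn : (localDegree F (vA α₀).1 : ℝ) ≠ 0 := by exact_mod_cast (localDegree_pos F (vA α₀).1).ne'
  have hfin : Module.finrank ℚ_[(p : ℕ)] (Kp F p (vA α₀)) = localDegree F (vA α₀).1 := by
    have h := (RescaledCompletion.localDeg_eq_finrank F p (vA α₀).1 (natCast_mem_of_mem_placesOver p (vA α₀).2)).symm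
    rw [localDeg_eq_localDegree] at h
    exact h
  have hdim : (Module.finrank ℚ_[(p : ℕ)] (PacketAlgebra p (fun α => Kp F p (vA α))) : ℝ) = localDegree F (vA α₀).1 := by
    rw [(packetSubsingletonAlgEquiv p (fun α => Kp F p (vA α)) α₀).toLinearEquiv.finrank_eq, hfin]
  have h2 : (normalizedIntegralStructure p (fun α => Kp F p (vA α))).logVolume S =
      (integerStructure p (fun α => Kp F p (vA α))).logVolume S -
        (integerStructure p (fun α => Kp F p (vA α))).logVolume
          (normalizedIntegralStructure p (fun α => Kp F p (vA α)) : Set (PacketAlgebra p (fun α => Kp F p (vA α)))) :=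
    (integerStructure p (fun α => Kp F p (vA α))).logVolume_eq_logVolume_sub _ hS.1 hS.2
  have hlog : (nonarchPortion F A p vA).logVol S =
      (normalizedIntegralStructure p (fun α => Kp F p (vA α))).logVolume S / localDegree F (vA α₀).1 := by
    show tensorLogVolume p (fun α => Kp F p (vA α)) S = _
    rw [tensorLogVolume, IntegralStructure.normalizedLogVolume, IntegralStructure.normalizedLogVolume, hdim, h2,
      coe_normalizedIntegralStructure, sub_div]
  rw [hlog, mul_div_cancel₀ _ hn]
  show (normalizedIntegralStructure p (fun α => Kp F p (vA α))).logVolume S =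
    Real.log ((nonarchDatum F (vA α₀).1).vol (singletonPortionEquiv F A p vA α₀ '' S)).toReal
  rw [← haar_normalizedIntegralStructure_eq_vol_image]
  rfl

/-- **WEIGHTED FORM — model weight × model log-volume agree term by term**: `(n_v/[F:ℚ])·μ^log_{⊗}(S) =
(1/[F:ℚ])·μ^log_v(e(S))`, i.e. p419250's `placeProbWeight × nonarchPortion.logVol` = p415871's `haarWeight ×
nonarchDatum.logVol` along the junction map (Remark 3.1.1 (ii) weights at `|A| = 1`, `K = F_mod`).
[claim: Mochizuki2012, status: disputed] -/
theorem placeProbWeight_mul_logVol_eq (S : Set (PacketAlgebra p (fun α => Kp F p (vA α))))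
    (hS : (nonarchPortion F A p vA).IsAdm S) :
    placeProbWeight F (Sum.inr (vA α₀).1) * (nonarchPortion F A p vA).logVol S =
      haarWeight F (Sum.inr (vA α₀).1) *
        (nonarchDatum F (vA α₀).1).logVol (singletonPortionEquiv F A p vA α₀ '' S) := by
  rw [placeProbWeight_inr, haarWeight_inr, ← localDegree_mul_logVol_eq_logVol_image F A p vA α₀ S hS]
  ring

/-- The transported region `e(S) ⊆ F_v` as an admissible region of the single-place datum.
[claim: Mochizuki2012, status: disputed] -/
def singletonRegion (S : (nonarchPortion F A p vA).Adm) : (nonarchDatum F (vA α₀).1).Adm :=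
  ⟨singletonPortionEquiv F A p vA α₀ '' S.1, (isAdm_iff_vol_image F A p vA α₀ S.1).mp S.2⟩

/-- Underlying set of the transported region. [claim: Mochizuki2012, status: disputed] -/
@[simp] theorem singletonRegion_val (S : (nonarchPortion F A p vA).Adm) :
    (singletonRegion F A p vA α₀ S).1 = singletonPortionEquiv F A p vA α₀ '' S.1 := rfl

end Nonarch

/-! ### §3 The packet over `p`: `μ^log_{A,p} = μ^log_p` at `|A| = 1` -/

section Packet

variable (p : Nat.Primes) [Fact (p : ℕ).Prime] (α₀ : A) [Subsingleton A]

/-- **The transported family**: from an admissible family `T` of the `A`-packet at `p` (`|A| = 1`: one portion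
`⊗_{α∈A} F_{v} ≅ F_v` per place `v | p`), the family `v ↦ e(T_{(v)})` of admissible regions of the single-place packet
`⊕_{v|p} F_v`. [claim: Mochizuki2012, status: disputed] -/
def singletonPacketRegion (T : ∀ π : Portion F A (RatPlace.prime p), (portionDatum F A (RatPlace.prime p) π).Adm) :
    ∀ v : Packet F (RatPlace.prime p), (placeDatum F v.1).Adm
  | ⟨Sum.inr w, h⟩ =>
      singletonRegion F A p (fun β => packetPrimeEquiv F p ((fun _ : A => (⟨Sum.inr w, h⟩ : Packet F _)) β)) α₀
        (T fun _ => ⟨Sum.inr w, h⟩)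
  | ⟨Sum.inl w, h⟩ => absurd h (ratPlaceBelow_inl_ne_prime F w p)

omit [Nonempty A] [DecidableEq A] in
include α₀ in
/-- For `|A| = 1` the portion weight of the constant tuple `(v)` is the place weight `n_v/[F:ℚ]` (one factor).
[claim: Mochizuki2012, status: disputed] -/
theorem portionWeight_const (q : RatPlace) (v : Packet F q) :
    portionWeight F A q (fun _ : A => v) = placeProbWeight F v.1 := by
  haveI : Unique A := uniqueOfSubsingleton α₀
  rw [portionWeight, Finset.prod_const, Finset.card_univ, Fintype.card_unique, pow_one]

/-- **[IUTchIII] Prop. 3.9 (i) at `|A| = 1`: `μ^log_{A,p}(T) = μ^log_p(e(T))` for EVERY admissible family.** The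
capsule packet log-volume of p419250 (`Σ_π portionWeight(π)·μ^log_π(T_π)`, portions `π : A → 𝕍(F)_p`) equals the
single-place packet log-volume of p415871 (`Σ_{v|p} c_v·μ^log_v`) on the transported family — the singleton-capsule
container and the single-place container of record are the SAME measure-theoretic object, not merely on ideal regions
(part VIII) but on all of "`𝕄(−)`". [claim: Mochizuki2012, status: disputed] -/
theorem capsulePacketLogVolume_prime_singleton
    (T : ∀ π : Portion F A (RatPlace.prime p), (portionDatum F A (RatPlace.prime p) π).Adm) :
    capsulePacketLogVolume F A (RatPlace.prime p) T =
      haarPacketLogVolume F (RatPlace.prime p) (singletonPacketRegion F A p α₀ T) := by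
  haveI : Unique A := uniqueOfSubsingleton α₀
  unfold capsulePacketLogVolume haarPacketLogVolume
  rw [← ((Equiv.funUnique A (Packet F (RatPlace.prime p))).symm.sum_comp
    (fun π => portionWeight F A (RatPlace.prime p) π * (portionDatum F A (RatPlace.prime p) π).logVol (T π).1))]
  refine Finset.sum_congr rfl fun v _ => ?_
  show portionWeight F A (RatPlace.prime p) (fun _ : A => v) *
      (portionDatum F A (RatPlace.prime p) (fun _ : A => v)).logVol (T fun _ => v).1 = _
  rw [portionWeight_const F A α₀]
  rcases v with ⟨w | w, h⟩
  · exact absurd h (ratPlaceBelow_inl_ne_prime F w p)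
  · exact placeProbWeight_mul_logVol_eq F A p
      (fun β => packetPrimeEquiv F p ((fun _ : A => (⟨Sum.inr w, h⟩ : Packet F _)) β)) α₀
      (T fun _ => ⟨Sum.inr w, h⟩).1 (T fun _ => ⟨Sum.inr w, h⟩).2

end Packet

end Literature.IUT.LogThetaLattice

end
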